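import Literature.Geometry.Riemannian.LinearHeatCauchyExistence
import HarnessLib

/-!
# The static linear heat-type Cauchy problem on closed connected Riemannian 4-manifolds
(stub `stub_staticLinearHeat`, Statement A of line `curvature-dimension-entropy-floor`, crux
`EntropyRung.SubcylindricalExistence`, item stmt-SmoothPoincare4-10871)

For a Riemannian metric `g` (Levi-Civita connection) on a closed connected 4-manifold of the
summit binder (model `ℝ⁴ = EuclideanSpace ℝ (Fin 4)`, `I = 𝓡 4`), every `T > 0`, every smooth
potential `Q` and every smooth datum `w₀`, the problem `∂ₛw = Δ_g w − Q w`, `w(0) = w₀` has a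
solution `C^∞` on `M × [0, T]` (one-sided time derivative within `[0, T]`): VERBATIM the
hypothesis `hLPs` of `carrilloNi_muEntropy_eq_log_shrinkerDensity_of_staticLinearHeat` and
`hLPM` of `heatDrift_finite_of_staticLinearHeat` (`WeightedHeatFlowFromLinearHeat.lean`) at this
model. It is the instance `m = 4` of the tree's existence theorem for the linear heat-type
Cauchy problem on closed manifolds modelled on `ℝᵐ`,
`Literature.Geometry.Riemannian.exists_staticLinearHeat` (`LinearHeatCauchyExistence.lean`:
Borel summation of the formal solution `exists_flat_corrector`, Lions' very weak solution
`exists_veryWeak_linearHeat`, Hörmander's hypoellipticity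
`exists_contMDiffOn_ae_eq_of_linearHeat_veryWeak`, uniqueness `linearHeat_unique`, exponential
shift). Everything is proved; no definition, no named fact.

References: A. Friedman, *Partial differential equations of parabolic type* (1964), Ch. 3,
Thm. 7 [Friedman1964]; F. Trèves, *Basic Linear Partial Differential Equations* (1975), §41
[Treves1975]; P. Topping, *Lectures on the Ricci flow* (2006), Rem. 8.2.5 [Topping2006].
-/

noncomputable section

-- the registered namespace `Summit.SmoothPoincare4.SmoothPoincare4.Theorems` repeats a component
set_option linter.dupNamespace false

open scoped Manifold ContDiff Topology ENNReal NNReal ContinuousMap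
open Set MeasureTheory
open Literature.Geometry.Lorentzian Literature.Geometry.Riemannian

namespace Summit.SmoothPoincare4.SmoothPoincare4.Theorems

/-- **Statement A — the static linear heat-type Cauchy problem on closed connected Riemannian
4-manifolds** (registered stub `stub_staticLinearHeat` of line `curvature-dimension-entropy-floor`):
for `g` Riemannian with Levi-Civita connection on a closed connected `M⁴` of the summit binder,
every `T > 0`, every smooth potential `Q` and every smooth datum `w₀`, the problem
`∂ₛw = Δ_g w − Q w`, `w(0) = w₀` has a solution `C^∞` on `M × [0, T]` (one-sided derivative
within `[0, T]`). The instance `m = 4`, `I = 𝓡 4` of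
`Literature.Geometry.Riemannian.exists_staticLinearHeat`. [cite: Friedman1964, Ch. 3, Thm. 7] -/
theorem stub_staticLinearHeat :
    ∀ (M : Type) [TopologicalSpace M] [T2Space M] [SecondCountableTopology M]
      [ChartedSpace (EuclideanSpace ℝ (Fin 4)) M] [IsManifold (𝓡 4) ∞ M] [CompactSpace M] [T3Space M]
      [MeasurableSpace M] [BorelSpace M] [ConnectedSpace M]
      (g : PseudoRiemannianMetric (𝓡 4) ∞ (EuclideanSpace ℝ (Fin 4)) (TangentSpace (𝓡 4) : M → Type _))
      [g.HasLeviCivita] (T : ℝ), 0 < T → g.IsRiemannian →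
      ∀ Q : M → ℝ, ContMDiff (𝓡 4) 𝓘(ℝ, ℝ) ∞ Q → ∀ w₀ : M → ℝ, ContMDiff (𝓡 4) 𝓘(ℝ, ℝ) ∞ w₀ →
        ∃ w : ℝ → M → ℝ,
          ContMDiffOn ((𝓡 4).prod 𝓘(ℝ, ℝ)) 𝓘(ℝ, ℝ) ∞ (fun p : M × ℝ ↦ w p.2 p.1) (univ ×ˢ Icc 0 T) ∧
          w 0 = w₀ ∧
          ∀ s ∈ Icc 0 T, ∀ x : M, HasDerivWithinAt (fun r ↦ w r x)
            (g.dalembertian (w s) x - Q x * w s x) (Icc 0 T) s := by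
  intro M _ _ _ _ _ _ _ _ _ _ g _ T hT hg Q hQ w₀ hw₀
  exact exists_staticLinearHeat g hg hT hQ hw₀

end Summit.SmoothPoincare4.SmoothPoincare4.Theorems

end
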